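import Summits.NavierStokesRegularity.NavierStokesRegularity.Theorems.StrainDoorsNearRecordStretchingBalance
import HarnessLib

/-!
# StrainDoorsNearRecordPinchRates — PART M §M13: RATE COMPLETION OF THE NEAR-RECORD PINCHING LAWS

nsreg-p1 g36, ROUND-64 (helper lane of `stmt-NavierStokesRegularity-0056`, rung N0; 0 ledger writes by the
planner — text for the S-lane to land `--supports stmt-NavierStokesRegularity-0056 --as helper`; tree file 1 of 4
of ROUND-64; bodies farm-certified inside `r64/StrainDoorsR64All.lean`, rc 0 · 0 warn · 0 sorry, std axioms).

ROUNDS 60 and 62 proved the STRETCHING PINCH `(0 − t)α ≤ 1 + K₃/w₀ + ε` and the TWIST PINCH / reduced-stretching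
floor at near-records in the QUALITATIVE form (`∃ δ > 0` by compactness + the tangent-flow identity).  With the
near-record laws with rates of ROUND 63 (`typeI_nearRecord_stretching_viscous_balance`,
`typeI_nearRecord_reduced_stretching_rate`) and ONE more class bound — the scale-invariant Laplacian bound
`(0 − t)²|Δω(t,x)| ≤ K(C₀)` (`typeI_laplacian_curl_bound`, from the uniform `D³`-bound of the class by the scaling
`λ⁴`) — both pinches get EXPLICIT rates, uniformly in the solution:

* ★ `typeI_laplacian_curl_bound` — `(0 − t)²·|Δ(curl u(t))(x)| ≤ K`;
* ★★ `typeI_nearRecord_stretching_pinch_rate` — `(0 − t)³⟪ω, ∇u ω⟫ ≤ ρ̂² + K·ρ̂ + √(A·W·δ)` (`ρ̂ = (0 − t)|ω(t,x)|`);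
* ★★ `typeI_nearRecord_stretching_pinch_rate'` — the `α`-form `ρ̂²·((0 − t)α − 1) ≤ K·ρ̂ + √(A·W·δ)`;
* ★★ `typeI_nearRecord_twist_pinch_rate` — `ρ̂²·(0 − t)|∇ξ|²_F ≤ K·ρ̂ + 2√(A·W·δ) + (A·W·δ)^(1/3)`.

All under GLOBAL domination `(0 − s)|ω(s,y)| ≤ W` (`s < 0`) and `W − δ ≤ ρ̂`, `δ ≥ 0` arbitrary.  ROUND 60/62's
`ε`-forms are the `δ → 0` shadows of these.  [new-as-typed]
-/

noncomputable section

open MeasureTheory Set Function Filter Metric Real InnerProductSpace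
open _root_.Topology
open scoped ENNReal NNReal RealInnerProductSpace ContDiff Laplacian
open Literature.Analysis Literature.Analysis.FluidPDE
open Literature.Analysis.FluidPDE.VorticityDirectionDynamics

set_option linter.dupNamespace false
set_option maxSynthPendingDepth 3

namespace Summit.NavierStokesRegularity.NavierStokesRegularity.Theorems.StrainDoors

open Summit.NavierStokesRegularity.NavierStokesRegularity.Theorems.ArgmaxDoors


/-! ## §M13 Rate completion: the stretching pinch and the twist pinch of ROUNDS 60/62 with explicit rates

ROUND 60 proved `(0 − t)α ≤ 1 + K₃/w₀ + ε` and ROUND 62 `(0 − t)|∇ξ|²_F ≤ K₃/w₀ + ε` at `δ`-near-records for an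
ineffective `δ(C₀,w₀,ε)`; the two-sided clock law of §M12 makes both quantitative and compactness-free. -/

/-- ★ **Scale-invariant Laplacian-of-vorticity bound in the Type-I class.**  For every `C₀ ≥ 0` there is
`K = K(C₀) ≥ 0` (`K = 12K₃`, `K₃` the uniform third-derivative bound of `exists_uniform_D3Bound`) with
`(0 − t)²·|Δω(t,x)| ≤ K` for every classical Type-I ancient solution, every `t < 0` and every `x`
(rescale to time `−1`; `|Δf| ≤ 3|∇²f|`, `|∇²curl v| ≤ 4|∇³v|`; `Δ(curl u_λ)(−1,z) = λ⁴Δ(curl u)(t,x)`). [new-as-typed; folklore] -/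
theorem typeI_laplacian_curl_bound {C₀ : ℝ} (hC₀ : 0 ≤ C₀) :
    ∃ K : ℝ, 0 ≤ K ∧ ∀ (u : ℝ → (EuclideanSpace ℝ (Fin 3)) → (EuclideanSpace ℝ (Fin 3)))
      (p : ℝ → (EuclideanSpace ℝ (Fin 3)) → ℝ) (t : ℝ) (x : EuclideanSpace ℝ (Fin 3)),
        IsClassicalNSSolutionOn (Iio 0) 1 0 u p → HasTypeIDecay C₀ u → t < 0 →
        (0 - t) ^ 2 * ‖(Δ (curl (u t))) x‖ ≤ K := by
  obtain ⟨K₃, hK₃, hD3⟩ := exists_uniform_D3Bound hC₀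
  refine ⟨12 * K₃, by positivity, fun u p t x hsol hI ht => ?_⟩
  -- rescale to time `-1`
  obtain ⟨lam, hlam⟩ : ∃ lam : ℝ, lam = √(0 - t) := ⟨_, rfl⟩
  have hlam0 : 0 < lam := by rw [hlam]; exact Real.sqrt_pos.mpr (by linarith)
  have hlam2 : lam ^ 2 = 0 - t := by rw [hlam]; exact Real.sq_sqrt (by linarith)
  have ht1 : lam ^ 2 * (-1) = t := by rw [hlam2]; ring
  obtain ⟨z, hz⟩ : ∃ z : EuclideanSpace ℝ (Fin 3), z = lam⁻¹ • x := ⟨_, rfl⟩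
  have hxz : lam • z = x := by rw [hz]; exact smul_inv_smul₀ hlam0.ne' _
  have hcl := (typeI_class_nsRescale hlam0 hsol hI).1
  have hI' := (typeI_class_nsRescale hlam0 hsol hI).2
  have hv' : ContDiff ℝ ∞ (nsRescale lam u (-1)) := hcl.contDiff_velocity (show (-1 : ℝ) ∈ Iio (0:ℝ) by norm_num)
  -- the bound at time `-1`
  have hB : ‖(Δ (curl (nsRescale lam u (-1)))) z‖ ≤ 12 * K₃ := by
    calc ‖(Δ (curl (nsRescale lam u (-1)))) z‖ ≤ 3 * ‖iteratedFDeriv ℝ 2 (curl (nsRescale lam u (-1))) z‖ :=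
          norm_laplacian_le_three_mul _ _
      _ ≤ 3 * (4 * ‖iteratedFDeriv ℝ 3 (nsRescale lam u (-1)) z‖) := by
          gcongr; exact norm_iteratedFDeriv_curl_le_four_mul hv' 2 z
      _ ≤ 3 * (4 * K₃) := by gcongr; exact hD3 hcl hI' (-1) (by norm_num) z
      _ = 12 * K₃ := by ring
  -- the scaling identity `Δ(curl u_λ(-1))(z) = λ⁴ • Δ(curl u(t))(x)`
  have htI : t ∈ Iio (0:ℝ) := ht
  have hω : ContDiff ℝ ∞ (curl (u t)) :=
    contDiff_curl (n := ⊤) ((hsol.contDiff_velocity htI).of_le (by exact_mod_cast (le_top : (⊤ + 1 : ℕ∞) ≤ ⊤)))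
  have hω' : ContDiff ℝ ∞ (curl (nsRescale lam u (-1))) :=
    contDiff_curl (n := ⊤) (hv'.of_le (by exact_mod_cast (le_top : (⊤ + 1 : ℕ∞) ≤ ⊤)))
  have hdir : ∀ {f : (EuclideanSpace ℝ (Fin 3)) → (EuclideanSpace ℝ (Fin 3))}, ContDiff ℝ ∞ f →
      ∀ (y e : EuclideanSpace ℝ (Fin 3)),
      iteratedFDeriv ℝ 2 f y ![e, e] = fderiv ℝ (fun y => fderiv ℝ f y e) y e := by
    intro f hf y e
    have hdd : DifferentiableAt ℝ (fderiv ℝ f) y :=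
      ((hf.fderiv_right (m := 1) (by norm_cast)).differentiable (by norm_cast)) y
    rw [iteratedFDeriv_two_apply, fderiv_clm_apply hdd (differentiableAt_const e), fderiv_fun_const]
    simp
  set b := stdOrthonormalBasis ℝ (EuclideanSpace ℝ (Fin 3)) with hb
  have hscale : (Δ (curl (nsRescale lam u (-1)))) z = (lam ^ 2 * lam * lam) • (Δ (curl (u t))) x := by
    rw [laplacian_eq_iteratedFDeriv_orthonormalBasis (curl (nsRescale lam u (-1))) b,
      laplacian_eq_iteratedFDeriv_orthonormalBasis (curl (u t)) b]
    simp only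
    rw [Finset.smul_sum]
    refine Finset.sum_congr rfl fun i _ => ?_
    rw [hdir hω' z (b i), hdir hω x (b i), fderiv_fderiv_curl_apply_nsRescale lam u (-1) z (b i), ht1, hxz]
    rfl
  have hlam4 : lam ^ 2 * lam * lam = (0 - t) ^ 2 := by rw [← hlam2]; ring
  rw [hscale, norm_smul, hlam4, Real.norm_of_nonneg (by positivity)] at hB
  exact hB

/-- ★★ **THE STRETCHING PINCH WITH A RATE (ROUND 60's `typeI_nearRecord_stretching_pinch`, quantitative and
compactness-free).**  For every `C₀ ≥ 0` there are `A, K ≥ 0` (depending on `C₀` only) such that at every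
`δ`-near-record point of a classical Type-I ancient solution with scale-invariant vorticity dominated by `W`
(all `s < 0`, all `y`):
`(0 − t)³⟪ω, ∇u·ω⟫(t,x) ≤ ((0 − t)|ω(t,x)|)² + K·(0 − t)|ω(t,x)| + √(A·W·δ)`,
i.e. with `ρ̂ = (0 − t)|ω|` and `α = ⟪ξ,∇u ξ⟫`: `(0 − t)α ≤ 1 + K/ρ̂ + √(A·W·δ)/ρ̂²`.  The upper half of the
two-sided clock law (`typeI_nearRecord_stretching_viscous_balance`) plus `(0 − t)³|⟪ω,Δω⟫| ≤ ρ̂·K`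
(`typeI_laplacian_curl_bound`). [new-as-typed] -/
theorem typeI_nearRecord_stretching_pinch_rate {C₀ : ℝ} (hC₀ : 0 ≤ C₀) :
    ∃ A K : ℝ, 0 ≤ A ∧ 0 ≤ K ∧
      ∀ (u : ℝ → (EuclideanSpace ℝ (Fin 3)) → (EuclideanSpace ℝ (Fin 3))) (p : ℝ → (EuclideanSpace ℝ (Fin 3)) → ℝ)
        (W t δ : ℝ) (x : EuclideanSpace ℝ (Fin 3)),
        IsClassicalNSSolutionOn (Iio 0) 1 0 u p → HasTypeIDecay C₀ u → t < 0 →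
        (∀ s : ℝ, s < 0 → ∀ y, (0 - s) * ‖curl (u s) y‖ ≤ W) → 0 ≤ δ → W - δ ≤ (0 - t) * ‖curl (u t) x‖ →
        (0 - t) ^ 3 * ⟪curl (u t) x, fderiv ℝ (u t) x (curl (u t) x)⟫ ≤
          ((0 - t) * ‖curl (u t) x‖) ^ 2 + K * ((0 - t) * ‖curl (u t) x‖) + √(A * W * δ) := by
  obtain ⟨A, hA, hvb⟩ := typeI_nearRecord_stretching_viscous_balance hC₀
  obtain ⟨K, hK, hLap⟩ := typeI_laplacian_curl_bound hC₀
  refine ⟨A, K, hA, hK, fun u p W t δ x hsol hI ht hdom hδ hnear => ?_⟩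
  have ht0 : 0 < 0 - t := by linarith
  have h1 := (abs_le.1 (hvb u p W t δ x hsol hI ht hdom hδ hnear)).2
  have hi := (abs_le.1 (abs_real_inner_le_norm (curl (u t) x) ((Δ (curl (u t))) x))).1
  have hL := hLap u p t x hsol hI ht
  set S := ⟪curl (u t) x, fderiv ℝ (u t) x (curl (u t) x)⟫ with hS
  set Lp := ⟪curl (u t) x, (Δ (curl (u t))) x⟫ with hLp
  set N := ‖(Δ (curl (u t))) x‖ with hN
  set w := ‖curl (u t) x‖ with hw
  have hw0 : 0 ≤ w := norm_nonneg _
  have ht3 : 0 ≤ (0 - t) ^ 3 := by positivity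
  have h3a : (0 - t) ^ 3 * (-(w * N)) ≤ (0 - t) ^ 3 * Lp := mul_le_mul_of_nonneg_left hi ht3
  have h3b : (0 - t) * w * ((0 - t) ^ 2 * N) ≤ (0 - t) * w * K :=
    mul_le_mul_of_nonneg_left hL (by positivity)
  have e : (0 - t) ^ 3 * (-(w * N)) = -((0 - t) * w * ((0 - t) ^ 2 * N)) := by ring
  nlinarith [h1, h3a, h3b, e]

/-- ★★ **The stretching pinch with a rate, `α`-form.**  Same constants; with `ξ = ω/|ω|`, `α = ⟪ξ, ∇u ξ⟫`
(`⟪ω,∇u ω⟫ = |ω|²α`, junk-free at `ω = 0`):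
`((0 − t)|ω|)²·((0 − t)α − 1)(t,x) ≤ K·(0 − t)|ω(t,x)| + √(A·W·δ)`. [new-as-typed] -/
theorem typeI_nearRecord_stretching_pinch_rate' {C₀ : ℝ} (hC₀ : 0 ≤ C₀) :
    ∃ A K : ℝ, 0 ≤ A ∧ 0 ≤ K ∧
      ∀ (u : ℝ → (EuclideanSpace ℝ (Fin 3)) → (EuclideanSpace ℝ (Fin 3))) (p : ℝ → (EuclideanSpace ℝ (Fin 3)) → ℝ)
        (W t δ : ℝ) (x : EuclideanSpace ℝ (Fin 3)),
        IsClassicalNSSolutionOn (Iio 0) 1 0 u p → HasTypeIDecay C₀ u → t < 0 →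
        (∀ s : ℝ, s < 0 → ∀ y, (0 - s) * ‖curl (u s) y‖ ≤ W) → 0 ≤ δ → W - δ ≤ (0 - t) * ‖curl (u t) x‖ →
        ((0 - t) * ‖curl (u t) x‖) ^ 2 *
            ((0 - t) * ⟪vorticityDirection (curl (u t)) x,
              fderiv ℝ (u t) x (vorticityDirection (curl (u t)) x)⟫ - 1) ≤
          K * ((0 - t) * ‖curl (u t) x‖) + √(A * W * δ) := by
  obtain ⟨A, K, hA, hK, hp⟩ := typeI_nearRecord_stretching_pinch_rate hC₀
  refine ⟨A, K, hA, hK, fun u p W t δ x hsol hI ht hdom hδ hnear => ?_⟩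
  have h := hp u p W t δ x hsol hI ht hdom hδ hnear
  have hstr : ⟪curl (u t) x, fderiv ℝ (u t) x (curl (u t) x)⟫ =
      ‖curl (u t) x‖ ^ 2 * ⟪vorticityDirection (curl (u t)) x,
        fderiv ℝ (u t) x (vorticityDirection (curl (u t)) x)⟫ := by
    conv_lhs => rw [← norm_smul_vorticityDirection (curl (u t)) x]
    rw [map_smul, real_inner_smul_left, real_inner_smul_right]
    ring
  rw [hstr] at h
  have e : ((0 - t) * ‖curl (u t) x‖) ^ 2 *
      ((0 - t) * ⟪vorticityDirection (curl (u t)) x, fderiv ℝ (u t) x (vorticityDirection (curl (u t)) x)⟫ - 1) =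
      (0 - t) ^ 3 * (‖curl (u t) x‖ ^ 2 *
        ⟪vorticityDirection (curl (u t)) x, fderiv ℝ (u t) x (vorticityDirection (curl (u t)) x)⟫) -
        ((0 - t) * ‖curl (u t) x‖) ^ 2 := by ring
  rw [e]
  obtain ⟨S, hS⟩ : ∃ S : ℝ, S = ‖curl (u t) x‖ ^ 2 *
      ⟪vorticityDirection (curl (u t)) x, fderiv ℝ (u t) x (vorticityDirection (curl (u t)) x)⟫ := ⟨_, rfl⟩
  obtain ⟨R, hR⟩ : ∃ R : ℝ, R = (0 - t) * ‖curl (u t) x‖ := ⟨_, rfl⟩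
  rw [← hS, ← hR] at h ⊢
  linarith

/-- ★★ **THE TWIST PINCH WITH A RATE (ROUND 62's `typeI_nearRecord_twist_pinch`, quantitative and
compactness-free).**  For every `C₀ ≥ 0` there are `A, K ≥ 0` such that at every `δ`-near-record point with
`ω(t,x) ≠ 0` (domination for all `s < 0`, all `y`), with the twist `|∇ξ|²_F` and `ρ̂ = (0 − t)|ω|`:
`ρ̂²·(0 − t)|∇ξ(t,x)|²_F ≤ K·ρ̂ + 2√(A·W·δ) + (A·W·δ)^{1/3}`,
i.e. `(0 − t)|∇ξ|²_F ≤ K/ρ̂ + O(δ^{1/3})/ρ̂²`.  Sum of the reduced-stretching floor with a rate (§M12) and the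
stretching pinch with a rate. [new-as-typed] -/
theorem typeI_nearRecord_twist_pinch_rate {C₀ : ℝ} (hC₀ : 0 ≤ C₀) :
    ∃ A K : ℝ, 0 ≤ A ∧ 0 ≤ K ∧
      ∀ (u : ℝ → (EuclideanSpace ℝ (Fin 3)) → (EuclideanSpace ℝ (Fin 3))) (p : ℝ → (EuclideanSpace ℝ (Fin 3)) → ℝ)
        (W t δ : ℝ) (x : EuclideanSpace ℝ (Fin 3)),
        IsClassicalNSSolutionOn (Iio 0) 1 0 u p → HasTypeIDecay C₀ u → t < 0 →
        (∀ s : ℝ, s < 0 → ∀ y, (0 - s) * ‖curl (u s) y‖ ≤ W) → 0 ≤ δ → W - δ ≤ (0 - t) * ‖curl (u t) x‖ →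
        curl (u t) x ≠ 0 →
        ((0 - t) * ‖curl (u t) x‖) ^ 2 *
            ((0 - t) * frobeniusNormSq (fderiv ℝ (vorticityDirection (curl (u t))) x)) ≤
          K * ((0 - t) * ‖curl (u t) x‖) + 2 * √(A * W * δ) + (A * W * δ) ^ (1 / 3 : ℝ) := by
  obtain ⟨A₁, hA₁, hred⟩ := typeI_nearRecord_reduced_stretching_rate hC₀
  obtain ⟨A₂, K, hA₂, hK, hp⟩ := typeI_nearRecord_stretching_pinch_rate' hC₀
  refine ⟨A₁ + A₂, K, by positivity, hK, fun u p W t δ x hsol hI ht hdom hδ hnear hne => ?_⟩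
  have ht0 : 0 < 0 - t := by linarith
  have hW0 : 0 ≤ W := by
    have h := hdom t ht x
    nlinarith [norm_nonneg (curl (u t) x)]
  have hWδ : 0 ≤ W * δ := mul_nonneg hW0 hδ
  have h1 := hred u p W t δ x hsol hI ht hdom hδ hnear hne
  have h2 := hp u p W t δ x hsol hI ht hdom hδ hnear
  have hs1 : √(A₁ * W * δ) ≤ √((A₁ + A₂) * W * δ) :=
    Real.sqrt_le_sqrt (by nlinarith)
  have hs2 : √(A₂ * W * δ) ≤ √((A₁ + A₂) * W * δ) :=
    Real.sqrt_le_sqrt (by nlinarith)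
  have hr1 : (A₁ * W * δ) ^ (1 / 3 : ℝ) ≤ ((A₁ + A₂) * W * δ) ^ (1 / 3 : ℝ) :=
    Real.rpow_le_rpow (by positivity) (by nlinarith) (by norm_num)
  obtain ⟨R, hR⟩ : ∃ R : ℝ, R = (0 - t) * ‖curl (u t) x‖ := ⟨_, rfl⟩
  obtain ⟨a, ha⟩ : ∃ a : ℝ, a = ⟪vorticityDirection (curl (u t)) x,
      fderiv ℝ (u t) x (vorticityDirection (curl (u t)) x)⟫ := ⟨_, rfl⟩
  obtain ⟨F, hF⟩ : ∃ F : ℝ, F = frobeniusNormSq (fderiv ℝ (vorticityDirection (curl (u t))) x) := ⟨_, rfl⟩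
  rw [← hR, ← hF] at h1 ⊢
  rw [← hR] at h2
  rw [← ha] at h1 h2
  have e1 : R ^ 2 * (1 - (0 - t) * (a - F)) = R ^ 2 - R ^ 2 * ((0 - t) * a) + R ^ 2 * ((0 - t) * F) := by ring
  have e2 : R ^ 2 * ((0 - t) * a - 1) = R ^ 2 * ((0 - t) * a) - R ^ 2 := by ring
  rw [e1] at h1
  rw [e2] at h2
  linarith

end Summit.NavierStokesRegularity.NavierStokesRegularity.Theorems.StrainDoors
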